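import Summits.Ventures.LatticeQCDFlow.Scaling.ConveyorLadder

/-!
HONEST FRAMING: exact (Metropolis-corrected) sampling algorithms for lattice gauge theory; figures
of merit are autocorrelation/cost numbers at stated couplings and volumes; no continuum-physics
claim.

# ConveyorLegs — THE TWO LEGS OF THE CONVEYOR COMPARISON PATH ON `Fin (K+1) → J`: RIDING A LABEL TO THE HOT
# END (`≤ (k/(p D κ))·`transposition Dirichlet terms) AND RELABELLING IT THERE
# (`≤ (2/(p D ρθ))·`hot-relabel Dirichlet terms), `D` THE DISPLACEMENT FACTOR (`= q^K` UNDER ONE-LEVEL COOLING)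
# (lean-2 GEN-18, ours)

Venture-side (OURS).  Cell `lqcd-flow` (pub-lqcd), unit `pub-lqcd-lean-2-g18`, 2026-08-25.  Second file of
chapter C (after `Scaling/ConveyorLadder`; assembled in `Scaling/ConveyorPoincare`).  Setting: mode assignments
`z : Fin (K+1) → J` with the product law `ν⊗ = tensorFun ν`; a matrix `Q ≥ 0` on them whose transposition
flows satisfy `ν⊗(z)Q(z, z∘σ_l) ≥ κ·min{ν⊗(z), ν⊗(z∘σ_l)}` and whose hot-relabel flows dominate `θ×` those of a
`ν_0`-chain `Q₀` on `J` of Poincaré constant `ρ` (`θ·ν⊗(z)Q₀(z_0,v) ≤ ν⊗(z)Q(z, update z 0 v)`, `v ≠ z_0`);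
persistence `p·ν_k(j) ≤ ν_i(j)` (`i ≤ k`: heating keeps the fraction `p`) and a DISPLACEMENT FACTOR `D > 0`:
`D·Π_j ν_{k.succAbove j}(r_j) ≤ Π_j ν_{i.succAbove j}(r_j)` for `i ≤ k` (pushing the labels between `i` and `k` one
level colder costs at most `D`; `D = q^K` under one-level cooling `q·ν_l ≤ ν_{l+1}` by
`Scaling/ConveyorLadder.prod_succAbove_ge`, and sharper choices are possible).  `U_k z` denotes
`insertNth 0 (z k) (removeNth k z)` — the label of level `k` bubbled to level `0`.

## What is proved

* `sum_bubble_eq`, `sum_state_eq_sum_insertNth` — reindexing sums over states by the bubbling bijections and by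
  separating out one coordinate (`Fin.insertNthEquiv`).
* §0 `tensorFun_bubble_ge_of_displacement` — every bubbled state weighs `≥ p·D·ν⊗(z)`; `displacement_of_cooling`
  — `D = q^K` under one-level cooling.
* §1 **`conveyor_arm_le`** — `Σ_z ν⊗(z)(f z − f(U_k z))² ≤ (k/(p D κ))·Σ_l Σ_w ν⊗(w)Q(w,w∘σ_l)(f w − f(w∘σ_l))²`:
  Cauchy–Schwarz along the `k` transpositions (`Scaling/SpiderPoincare.sq_sub_head_le`), each intermediate
  state weighing `≥ p D ν⊗(z)`, each step a bijective image of the state space (self-loops drop out).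
* §2 **`conveyor_source_le`** —
  `Σ_z Σ_v ν⊗(z)ν_k(v)(f(U_k z) − f(update (U_k z) 0 v))² ≤ (2/(p D ρθ))·½Σ_z Σ_v ν⊗(z)Q(z,z⁰ᵛ)(f z − f z⁰ᵛ)²`:
  separate out coordinate `k`, `Var_{ν_k} ≤ p⁻¹Var_{ν_0}`, the hot chain's Poincaré inequality, domination at
  the hot position, and `D⁻¹` for the rest of the state read one level colder.

NOT CLAIMED: the Poincaré inequality itself (`Scaling/ConveyorPoincare`); anything about a specific sampler.
Literature grade (cell rule): KNOWN MECHANISM (comparison paths for interchange processes, Diaconis–Saloff-Coste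
1993; Woodard–Schmidler–Huber 2009), NEW TYPING; nothing cited as a fact; no new bib keys.
-/

noncomputable section

open Finset Function
open Literature.Probability.MarkovChains

namespace Summit.Ventures.LatticeQCDFlow.Scaling

section Conveyor

variable {J : Type*} [Fintype J] [DecidableEq J] {K : ℕ} {ν : Fin (K + 1) → J → ℝ}
  {Q : Matrix (Fin (K + 1) → J) (Fin (K + 1) → J) ℝ}

omit [DecidableEq J] in
/-- Reindexing by a bubbling bijection: `Σ_z G(insertNth i (z k) (removeNth k z)) = Σ_w G(w)`. [ours] -/
theorem sum_bubble_eq (k i : Fin (K + 1)) (G : (Fin (K + 1) → J) → ℝ) :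
    ∑ z : Fin (K + 1) → J, G (Fin.insertNth i (z k) (Fin.removeNth k z)) = ∑ w, G w := by
  have h := Equiv.sum_comp
    ((Fin.insertNthEquiv (fun _ => J) k).symm.trans (Fin.insertNthEquiv (fun _ => J) i)) G
  simpa [Equiv.trans_apply, Fin.insertNthEquiv] using h

omit [DecidableEq J] in
/-- Reindexing by separating out one coordinate: `Σ_z G(z) = Σ_a Σ_r G(insertNth k a r)`. [ours] -/
theorem sum_state_eq_sum_insertNth (k : Fin (K + 1)) (G : (Fin (K + 1) → J) → ℝ) :
    ∑ z : Fin (K + 1) → J, G z = ∑ a : J, ∑ r : Fin K → J, G (Fin.insertNth k a r) := by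
  rw [← Equiv.sum_comp (Fin.insertNthEquiv (fun _ => J) k) G, Fintype.sum_prod_type]
  simp [Fin.insertNthEquiv]

/-! ## §0 The displacement factor -/

omit [Fintype J] [DecidableEq J] in
/-- **Every bubbled state keeps the fraction `p·D` of the weight:** persistence `p·ν_k(j) ≤ ν_i(j)` (`i ≤ k`) for the
travelling label and the displacement factor `D` for the labels pushed one level colder. [ours] -/
theorem tensorFun_bubble_ge_of_displacement (hν0 : ∀ k j, 0 ≤ ν k j) {p D : ℝ} (hD0 : 0 ≤ D)
    (hpers : ∀ (i k : Fin (K + 1)) (j : J), i ≤ k → p * ν k j ≤ ν i j)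
    (hD : ∀ (i k : Fin (K + 1)), i ≤ k → ∀ r : Fin K → J,
      D * ∏ j, ν (k.succAbove j) (r j) ≤ ∏ j, ν (i.succAbove j) (r j))
    {i k : Fin (K + 1)} (hik : i ≤ k) (z : Fin (K + 1) → J) :
    p * D * tensorFun ν z ≤ tensorFun ν (Fin.insertNth i (z k) (Fin.removeNth k z) : Fin (K + 1) → J) := by
  rw [tensorFun_eq_insertNth ν k z, tensorFun_insertNth]
  have hP0 : 0 ≤ ∏ j, ν (k.succAbove j) (Fin.removeNth k z j) := prod_nonneg fun j _ => hν0 _ _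
  calc p * D * (ν k (z k) * ∏ j, ν (k.succAbove j) (Fin.removeNth k z j))
      = (p * ν k (z k)) * (D * ∏ j, ν (k.succAbove j) (Fin.removeNth k z j)) := by ring
    _ ≤ ν i (z k) * ∏ j, ν (i.succAbove j) (Fin.removeNth k z j) :=
        mul_le_mul (hpers i k (z k) hik) (hD i k hik _) (mul_nonneg hD0 hP0) (hν0 _ _)

omit [Fintype J] [DecidableEq J] in
/-- **One-level cooling gives the displacement factor `D = q^K`:** `q·ν_l(j) ≤ ν_{l+1}(j)` (`0 ≤ q ≤ 1`) ⇒
`q^K·Π_j ν_{k.succAbove j}(r_j) ≤ Π_j ν_{i.succAbove j}(r_j)` for `i ≤ k` (`Scaling/ConveyorLadder.prod_succAbove_ge`).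
[ours] -/
theorem displacement_of_cooling (hν0 : ∀ k j, 0 ≤ ν k j) {q : ℝ} (hq0 : 0 ≤ q) (hq1 : q ≤ 1)
    (hq : ∀ (l : Fin K) (j : J), q * ν l.castSucc j ≤ ν l.succ j) :
    ∀ (i k : Fin (K + 1)), i ≤ k → ∀ r : Fin K → J,
      q ^ K * ∏ j, ν (k.succAbove j) (r j) ≤ ∏ j, ν (i.succAbove j) (r j) :=
  fun _ _ hik r => prod_succAbove_ge hν0 hq0 hq1 hq hik r

/-! ## §1 The arm: riding to the hot end -/

omit [DecidableEq J] in
/-- **THE ARM BOUND.**  `Σ_z ν⊗(z)(f z − f(U_k z))² ≤ (k/(p q^K κ))·Σ_l Σ_w ν⊗(w)Q(w, w∘σ_l)(f w − f(w∘σ_l))²`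
with `U_k z = insertNth 0 (z k) (removeNth k z)`. [ours] -/
theorem conveyor_arm_le (hν0 : ∀ k j, 0 ≤ ν k j) {p D κ : ℝ} (hp : 0 < p) (hD0 : 0 < D)
    (hκ : 0 < κ) (hpers : ∀ (i k : Fin (K + 1)) (j : J), i ≤ k → p * ν k j ≤ ν i j)
    (hD : ∀ (i k : Fin (K + 1)), i ≤ k → ∀ r : Fin K → J,
      D * ∏ j, ν (k.succAbove j) (r j) ≤ ∏ j, ν (i.succAbove j) (r j)) (hQ0 : ∀ z y, 0 ≤ Q z y)
    (hT : ∀ (z : Fin (K + 1) → J) (l : Fin K), z ∘ Equiv.swap l.castSucc l.succ ≠ z →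
      κ * min (tensorFun ν z) (tensorFun ν (z ∘ Equiv.swap l.castSucc l.succ))
        ≤ tensorFun ν z * Q z (z ∘ Equiv.swap l.castSucc l.succ))
    (f : (Fin (K + 1) → J) → ℝ) (k : Fin (K + 1)) :
    ∑ z : Fin (K + 1) → J, tensorFun ν z * (f z - f (Fin.insertNth 0 (z k) (Fin.removeNth k z))) ^ 2
      ≤ (k : ℝ) / (p * D * κ) * ∑ l : Fin K, ∑ w : Fin (K + 1) → J,
          tensorFun ν w * Q w (w ∘ Equiv.swap l.castSucc l.succ)
            * (f w - f (w ∘ Equiv.swap l.castSucc l.succ)) ^ 2 := by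
  -- the bubbled states and the transposition terms
  set B : (Fin (K + 1) → J) → Fin (K + 1) → (Fin (K + 1) → J) :=
    fun z i => Fin.insertNth i (z k) (Fin.removeNth k z) with hB
  set T : Fin K → ℝ := fun l => ∑ w : Fin (K + 1) → J,
    tensorFun ν w * Q w (w ∘ Equiv.swap l.castSucc l.succ) * (f w - f (w ∘ Equiv.swap l.castSucc l.succ)) ^ 2
    with hTdef
  have hW0 : ∀ z, 0 ≤ tensorFun ν z := fun z => prod_nonneg fun i _ => hν0 _ _
  have hT0 : ∀ l, 0 ≤ T l := fun l => sum_nonneg fun w _ =>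
    mul_nonneg (mul_nonneg (hW0 w) (hQ0 _ _)) (sq_nonneg _)
  have hpqκ : 0 < p * D * κ := by positivity
  have hBk : ∀ z, B z k = z := fun z => Fin.insertNth_self_removeNth k z
  -- Cauchy–Schwarz along the arm
  have h1 : ∀ z, (f z - f (B z 0)) ^ 2
      ≤ (k : ℝ) * ∑ l : Fin K, (if l.val < k.val then (f (B z l.succ) - f (B z l.castSucc)) ^ 2 else 0) := by
    intro z
    have h := sq_sub_head_le (fun i => f (B z i)) k
    simp only [hBk] at h
    exact h
  -- one transposition step, weighted
  have h2 : ∀ (z : Fin (K + 1) → J) (l : Fin K),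
      tensorFun ν z * (if l.val < k.val then (f (B z l.succ) - f (B z l.castSucc)) ^ 2 else 0)
        ≤ 1 / (p * D * κ) * (tensorFun ν (B z l.succ) * Q (B z l.succ) (B z l.succ ∘ Equiv.swap l.castSucc l.succ)
            * (f (B z l.succ) - f (B z l.succ ∘ Equiv.swap l.castSucc l.succ)) ^ 2) := by
    intro z l
    have hRHS0 : 0 ≤ 1 / (p * D * κ) * (tensorFun ν (B z l.succ) * Q (B z l.succ)
        (B z l.succ ∘ Equiv.swap l.castSucc l.succ)
          * (f (B z l.succ) - f (B z l.succ ∘ Equiv.swap l.castSucc l.succ)) ^ 2) :=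
      mul_nonneg (div_nonneg zero_le_one hpqκ.le) (mul_nonneg (mul_nonneg (hW0 _) (hQ0 _ _)) (sq_nonneg _))
    split_ifs with hlk
    · have hcs : B z l.castSucc = B z l.succ ∘ Equiv.swap l.castSucc l.succ := by
        simp only [hB]; exact insertNth_castSucc_comp_swap l (z k) (Fin.removeNth k z)
      by_cases hmove : B z l.succ ∘ Equiv.swap l.castSucc l.succ = B z l.succ
      · -- the two labels coincide: the step is a self-loop and the left side vanishes
        have e1 : f (B z l.succ) - f (B z l.castSucc) = 0 := by rw [hcs, hmove, sub_self]
        rw [e1, zero_pow two_ne_zero, mul_zero]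
        exact hRHS0
      rw [← hcs]
      have hle1 : l.succ ≤ k := by
        rw [Fin.le_iff_val_le_val, Fin.val_succ]; omega
      have hle2 : l.castSucc ≤ k := (Fin.castSucc_lt_succ (i := l)).le.trans hle1
      have w1 := tensorFun_bubble_ge_of_displacement hν0 hD0.le hpers hD hle1 z
      have w2 := tensorFun_bubble_ge_of_displacement hν0 hD0.le hpers hD hle2 z
      have wmin : p * D * tensorFun ν z ≤ min (tensorFun ν (B z l.succ)) (tensorFun ν (B z l.castSucc)) :=
        le_min w1 w2
      have hflow := hT (B z l.succ) l hmove
      rw [← hcs] at hflow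
      have key : p * D * κ * tensorFun ν z ≤ tensorFun ν (B z l.succ) * Q (B z l.succ) (B z l.castSucc) :=
        calc p * D * κ * tensorFun ν z = κ * (p * D * tensorFun ν z) := by ring
          _ ≤ κ * min (tensorFun ν (B z l.succ)) (tensorFun ν (B z l.castSucc)) :=
              mul_le_mul_of_nonneg_left wmin hκ.le
          _ ≤ tensorFun ν (B z l.succ) * Q (B z l.succ) (B z l.castSucc) := hflow
      rw [← mul_assoc, one_div, ← div_eq_inv_mul]
      refine mul_le_mul_of_nonneg_right ?_ (sq_nonneg _)
      rw [le_div_iff₀ hpqκ]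
      calc tensorFun ν z * (p * D * κ) = p * D * κ * tensorFun ν z := by ring
        _ ≤ tensorFun ν (B z l.succ) * Q (B z l.succ) (B z l.castSucc) := key
    · rw [mul_zero]
      exact hRHS0
  -- reindex each step by the bubbling bijection
  have h3 : ∀ l : Fin K, ∑ z : Fin (K + 1) → J,
      tensorFun ν (B z l.succ) * Q (B z l.succ) (B z l.succ ∘ Equiv.swap l.castSucc l.succ)
        * (f (B z l.succ) - f (B z l.succ ∘ Equiv.swap l.castSucc l.succ)) ^ 2 = T l := by
    intro l
    simp only [hB, hTdef]
    exact sum_bubble_eq k l.succ (fun w => tensorFun ν w * Q w (w ∘ Equiv.swap l.castSucc l.succ)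
      * (f w - f (w ∘ Equiv.swap l.castSucc l.succ)) ^ 2)
  calc ∑ z : Fin (K + 1) → J, tensorFun ν z * (f z - f (B z 0)) ^ 2
      ≤ ∑ z : Fin (K + 1) → J, tensorFun ν z * ((k : ℝ) * ∑ l : Fin K,
          (if l.val < k.val then (f (B z l.succ) - f (B z l.castSucc)) ^ 2 else 0)) :=
        sum_le_sum fun z _ => mul_le_mul_of_nonneg_left (h1 z) (hW0 z)
    _ = (k : ℝ) * ∑ l : Fin K, ∑ z : Fin (K + 1) → J, tensorFun ν z
          * (if l.val < k.val then (f (B z l.succ) - f (B z l.castSucc)) ^ 2 else 0) := by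
        rw [sum_comm, mul_sum]
        refine sum_congr rfl fun z _ => ?_
        rw [mul_sum, mul_sum, mul_sum]
        exact sum_congr rfl fun l _ => by ring
    _ ≤ (k : ℝ) * ∑ l : Fin K, ∑ z : Fin (K + 1) → J, 1 / (p * D * κ)
          * (tensorFun ν (B z l.succ) * Q (B z l.succ) (B z l.succ ∘ Equiv.swap l.castSucc l.succ)
            * (f (B z l.succ) - f (B z l.succ ∘ Equiv.swap l.castSucc l.succ)) ^ 2) :=
        mul_le_mul_of_nonneg_left (sum_le_sum fun l _ => sum_le_sum fun z _ => h2 z l) (Nat.cast_nonneg _)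
    _ = (k : ℝ) * ∑ l : Fin K, 1 / (p * D * κ) * T l := by
        congr 1
        refine sum_congr rfl fun l _ => ?_
        rw [← mul_sum, h3 l]
    _ = (k : ℝ) / (p * D * κ) * ∑ l : Fin K, T l := by
        rw [← mul_sum, ← mul_assoc, mul_one_div]

/-! ## §2 The source: relabelling at the hot end -/

/-- **THE SOURCE BOUND.**
`Σ_z Σ_v ν⊗(z)ν_k(v)(f(U_k z) − f(update (U_k z) 0 v))² ≤ (2/(p q^K ρθ))·½Σ_z Σ_v ν⊗(z)Q(z,z⁰ᵛ)(f z − f z⁰ᵛ)²`.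
[ours] -/
theorem conveyor_source_le (hν0 : ∀ k j, 0 ≤ ν k j) (hν1 : ∀ k, ∑ j, ν k j = 1) {p D ρ θ : ℝ}
    (hp : 0 < p) (hD0 : 0 < D) (hρ : 0 < ρ) (hθ : 0 < θ)
    (hpers : ∀ (i k : Fin (K + 1)) (j : J), i ≤ k → p * ν k j ≤ ν i j)
    (hD : ∀ (i k : Fin (K + 1)), i ≤ k → ∀ r : Fin K → J,
      D * ∏ j, ν (k.succAbove j) (r j) ≤ ∏ j, ν (i.succAbove j) (r j))
    {Q₀ : Matrix J J ℝ} (hρvar : ∀ h : J → ℝ, ρ * lawVariance (ν 0) h ≤ dirichletForm (ν 0) Q₀ h)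
    (hR : ∀ (z : Fin (K + 1) → J) (v : J), v ≠ z 0 →
      θ * (tensorFun ν z * Q₀ (z 0) v) ≤ tensorFun ν z * Q z (update z 0 v))
    (f : (Fin (K + 1) → J) → ℝ) (k : Fin (K + 1)) :
    ∑ z : Fin (K + 1) → J, ∑ v, tensorFun ν z * ν k v
        * (f (Fin.insertNth 0 (z k) (Fin.removeNth k z))
            - f (update (Fin.insertNth 0 (z k) (Fin.removeNth k z) : Fin (K + 1) → J) 0 v)) ^ 2
      ≤ 2 / (p * D * ρ * θ) * ((1 / 2) * ∑ z : Fin (K + 1) → J, ∑ v,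
          tensorFun ν z * Q z (update z 0 v) * (f z - f (update z 0 v)) ^ 2) := by
  -- the rest of the state, read below `k` (`R_k`) and from level `1` on (`R_0`)
  set Rk : (Fin K → J) → ℝ := fun r => ∏ j, ν (k.succAbove j) (r j) with hRk
  set R0 : (Fin K → J) → ℝ := fun r => ∏ j, ν j.succ (r j) with hR0
  set h : (Fin K → J) → J → ℝ := fun r a => f (Fin.insertNth 0 a r) with hh
  have hRk0 : ∀ r, 0 ≤ Rk r := fun r => prod_nonneg fun j _ => hν0 _ _
  have hR00 : ∀ r, 0 ≤ R0 r := fun r => prod_nonneg fun j _ => hν0 _ _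
  have hRkR0 : ∀ r, D * Rk r ≤ R0 r := fun r => by
    have h := hD 0 k (Fin.zero_le k) r
    simpa only [Fin.succAbove_zero] using h
  have hpρ : 0 < p * ρ := mul_pos hp hρ
  have hall : 0 < p * D * ρ * θ := by positivity
  -- Step 1: separate out coordinate `k` on the left
  have L1 : ∑ z : Fin (K + 1) → J, ∑ v, tensorFun ν z * ν k v
        * (f (Fin.insertNth 0 (z k) (Fin.removeNth k z))
            - f (update (Fin.insertNth 0 (z k) (Fin.removeNth k z) : Fin (K + 1) → J) 0 v)) ^ 2
      = ∑ r : Fin K → J, Rk r * ∑ a, ∑ v, ν k a * ν k v * (h r a - h r v) ^ 2 := by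
    rw [sum_state_eq_sum_insertNth k, sum_comm]
    refine sum_congr rfl fun r _ => ?_
    rw [mul_sum]
    refine sum_congr rfl fun a _ => ?_
    rw [mul_sum]
    refine sum_congr rfl fun v _ => ?_
    simp only [Fin.insertNth_apply_same, Fin.removeNth_insertNth, Fin.update_insertNth, hh, hRk,
      tensorFun_insertNth]
    ring
  -- Step 2: the inner double sum is twice a `ν_k`-variance, at most `(2/(pρ))·𝓔_{ν_0}(Q₀; h_r)`
  have L2 : ∀ r, ∑ a, ∑ v, ν k a * ν k v * (h r a - h r v) ^ 2
      ≤ 1 / (p * ρ) * ∑ a, ∑ v, ν 0 a * Q₀ a v * (h r a - h r v) ^ 2 := by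
    intro r
    have e1 : ∑ a, ∑ v, ν k a * ν k v * (h r a - h r v) ^ 2 = 2 * lawVariance (ν k) (h r) := by
      rw [lawVariance_eq_half_sum (hν1 k)]
      rw [← mul_assoc, show (2 : ℝ) * (1 / 2) = 1 by norm_num, one_mul]
      exact sum_congr rfl fun a _ => sum_congr rfl fun v _ => by ring
    have e2 : lawVariance (ν k) (h r) ≤ ∑ a, ν k a * (h r a - lawMean (ν 0) (h r)) ^ 2 := by
      rw [meanSq_eq_lawVariance_add_sq (hν1 k)]
      nlinarith [sq_nonneg (lawMean (ν k) (h r) - lawMean (ν 0) (h r))]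
    have e3 : ∑ a, ν k a * (h r a - lawMean (ν 0) (h r)) ^ 2 ≤ 1 / p * lawVariance (ν 0) (h r) := by
      unfold lawVariance
      rw [mul_sum]
      refine sum_le_sum fun a _ => ?_
      rw [← mul_assoc]
      refine mul_le_mul_of_nonneg_right ?_ (sq_nonneg _)
      rw [one_div, inv_mul_eq_div, le_div_iff₀ hp, mul_comm]
      exact hpers 0 k a (Fin.zero_le _)
    have e4 : lawVariance (ν 0) (h r) ≤ 1 / ρ * dirichletForm (ν 0) Q₀ (h r) := by
      rw [one_div, inv_mul_eq_div, le_div_iff₀ hρ, mul_comm]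
      exact hρvar (h r)
    have e5 : dirichletForm (ν 0) Q₀ (h r) = (1 / 2) * ∑ a, ∑ v, ν 0 a * Q₀ a v * (h r a - h r v) ^ 2 := rfl
    calc ∑ a, ∑ v, ν k a * ν k v * (h r a - h r v) ^ 2 = 2 * lawVariance (ν k) (h r) := e1
      _ ≤ 2 * (1 / p * (1 / ρ * ((1 / 2) * ∑ a, ∑ v, ν 0 a * Q₀ a v * (h r a - h r v) ^ 2))) := by
          rw [← e5]
          refine mul_le_mul_of_nonneg_left (le_trans e2 (le_trans e3 ?_)) (by norm_num)
          exact mul_le_mul_of_nonneg_left e4 (by positivity)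
      _ = 1 / (p * ρ) * ∑ a, ∑ v, ν 0 a * Q₀ a v * (h r a - h r v) ^ 2 := by
          field_simp
  -- Step 3: domination at the hot position, then back to a sum over states
  have L3 : ∀ r a v, θ * (ν 0 a * R0 r * Q₀ a v * (h r a - h r v) ^ 2)
      ≤ tensorFun ν (Fin.insertNth 0 a r) * Q (Fin.insertNth 0 a r) (update (Fin.insertNth 0 a r) 0 v)
          * (f (Fin.insertNth 0 a r) - f (update (Fin.insertNth 0 a r : Fin (K + 1) → J) 0 v)) ^ 2 := by
    intro r a v
    have hW : tensorFun ν (Fin.insertNth 0 a r) = ν 0 a * R0 r := by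
      rw [tensorFun_insertNth]; simp [hR0]
    by_cases hva : v = a
    · subst hva
      simp only [hh, Fin.update_insertNth, sub_self]
      simp
    · have hd := hR (Fin.insertNth 0 a r) v (by rwa [Fin.insertNth_apply_same])
      rw [Fin.insertNth_apply_same, hW] at hd
      simp only [Fin.update_insertNth] at hd
      simp only [hh, Fin.update_insertNth]
      rw [hW]
      calc θ * (ν 0 a * R0 r * Q₀ a v * (f (Fin.insertNth 0 a r) - f (Fin.insertNth 0 v r)) ^ 2)
          = θ * (ν 0 a * R0 r * Q₀ a v) * (f (Fin.insertNth 0 a r) - f (Fin.insertNth 0 v r)) ^ 2 := by ring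
        _ ≤ ν 0 a * R0 r * Q (Fin.insertNth 0 a r) (Fin.insertNth 0 v r)
              * (f (Fin.insertNth 0 a r) - f (Fin.insertNth 0 v r)) ^ 2 :=
            mul_le_mul_of_nonneg_right hd (sq_nonneg _)
  have L4 : ∑ r : Fin K → J, ∑ a, ∑ v, tensorFun ν (Fin.insertNth 0 a r)
        * Q (Fin.insertNth 0 a r) (update (Fin.insertNth 0 a r) 0 v)
        * (f (Fin.insertNth 0 a r) - f (update (Fin.insertNth 0 a r : Fin (K + 1) → J) 0 v)) ^ 2
      = ∑ z : Fin (K + 1) → J, ∑ v, tensorFun ν z * Q z (update z 0 v) * (f z - f (update z 0 v)) ^ 2 := by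
    rw [sum_state_eq_sum_insertNth 0, sum_comm]
  -- assembly
  rw [L1]
  calc ∑ r : Fin K → J, Rk r * ∑ a, ∑ v, ν k a * ν k v * (h r a - h r v) ^ 2
      ≤ ∑ r : Fin K → J, (1 / D * R0 r) * (1 / (p * ρ) * ∑ a, ∑ v, ν 0 a * Q₀ a v * (h r a - h r v) ^ 2) := by
        refine sum_le_sum fun r _ => mul_le_mul ?_ (L2 r) ?_ ?_
        · rw [one_div, inv_mul_eq_div, le_div_iff₀ hD0, mul_comm]; exact hRkR0 r
        · exact sum_nonneg fun a _ => sum_nonneg fun v _ =>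
            mul_nonneg (mul_nonneg (hν0 _ _) (hν0 _ _)) (sq_nonneg _)
        · exact mul_nonneg (div_nonneg zero_le_one hD0.le) (hR00 r)
    _ = 1 / (p * D * ρ * θ) * ∑ r : Fin K → J, ∑ a, ∑ v,
          θ * (ν 0 a * R0 r * Q₀ a v * (h r a - h r v) ^ 2) := by
        simp only [mul_sum]
        refine sum_congr rfl fun r _ => sum_congr rfl fun a _ => sum_congr rfl fun v _ => ?_
        field_simp
    _ ≤ 1 / (p * D * ρ * θ) * ∑ r : Fin K → J, ∑ a, ∑ v, tensorFun ν (Fin.insertNth 0 a r)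
          * Q (Fin.insertNth 0 a r) (update (Fin.insertNth 0 a r) 0 v)
          * (f (Fin.insertNth 0 a r) - f (update (Fin.insertNth 0 a r : Fin (K + 1) → J) 0 v)) ^ 2 :=
        mul_le_mul_of_nonneg_left
          (sum_le_sum fun r _ => sum_le_sum fun a _ => sum_le_sum fun v _ => L3 r a v) (by positivity)
    _ = 2 / (p * D * ρ * θ) * ((1 / 2) * ∑ z : Fin (K + 1) → J, ∑ v,
          tensorFun ν z * Q z (update z 0 v) * (f z - f (update z 0 v)) ^ 2) := by
        rw [L4]
        ring

end Conveyor

end Summit.Ventures.LatticeQCDFlow.Scaling
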